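import Summits.AtomisticToContinuum.HydrodynamicLimit.Theses.JParityClosure
import Summits.AtomisticToContinuum.HydrodynamicLimit.Theorems.DensityCap.Negative.MollifiedDensity
import Literature.Analysis.FluidPDE.HardSphereDynamicsProofs
import Literature.Analysis.FluidPDE.HardSphereRegularGeometry
import Literature.Analysis.FluidPDE.HardSphereTorusMeasure
import Mathlib.Analysis.Calculus.MeanValue

/-!
# drefute gen-2: STUB A `stub_meanDisplacement` of line `lipschitz-clock-free-past-cap`
(crux `JParityClosure.DensityCap`, stmt-AtomisticToContinuum-13082) — PROVED VERBATIM

The trajectory half of the Lipschitz clock: along the orbit of a good point of any hard-sphere flow on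
`𝕋³`, the mean minimal-image displacement between times `s` and `s'` is at most `√(2K/n)·|s' − s|`,
`K = configEnergy z`.  Proof = the docstring's route, kernel-checked, at TRAJECTORY level
(`traj_meanDisplacement_le`, any `IsHardSphereTrajectory` on `𝕋³`): `f(τ) := n⁻¹ ∑ᵢ d(xᵢ(τ), xᵢ(s))`
is continuous (`pos_continuous`, `Torus.continuous_euclidDist`); at every `τ` the orbit is free flight on a
right-neighbourhood (`exists_Ioo_right_free`, `eq_freeFlight_of_Ioo_free`), where the slope of `f` is at
most `n⁻¹∑‖vᵢ(τ)‖ ≤ √(n⁻¹∑‖vᵢ(τ)‖²) = √(2K(γ τ)/n) = √(2K(γ s)/n)` (minimal image ≤ lift, Cauchy–Schwarz,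
`configEnergy_eq_holds`); the fencing lemma `image_le_of_liminf_slope_right_le_deriv_boundary` closes
`[s, s']`; `s' < s` by symmetry of `euclidDist`; `flow_zero` identifies `K(γ 0)` with `K(z)`.
refuter-drefute-stmt-AtomisticToContinuum-13082-g2-0, 2026-08-16.
-/

noncomputable section

namespace DrefuteG2.StubA

open MeasureTheory Filter Set Topology
open scoped BigOperators
open Literature.MathematicalPhysics.KineticTheory Literature.Analysis.FluidPDE

/-- Mean ≤ quadratic mean (Cauchy–Schwarz), in the form the clock needs. -/
theorem mean_le_sqrt_mean_sq {n : ℕ} (a : Fin n → ℝ) (ha : ∀ i, 0 ≤ a i) :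
    (n : ℝ)⁻¹ * ∑ i, a i ≤ Real.sqrt ((n : ℝ)⁻¹ * ∑ i, a i ^ 2) := by
  rcases Nat.eq_zero_or_pos n with hn | hn
  · subst hn
    simp
  have hn' : (0 : ℝ) < n := by exact_mod_cast hn
  have hsum : 0 ≤ ∑ i, a i := Finset.sum_nonneg fun i _ => ha i
  have hlhs : 0 ≤ (n : ℝ)⁻¹ * ∑ i, a i := mul_nonneg (inv_nonneg.2 hn'.le) hsum
  rw [show (n : ℝ)⁻¹ * ∑ i, a i = Real.sqrt (((n : ℝ)⁻¹ * ∑ i, a i) ^ 2) from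
    (Real.sqrt_sq hlhs).symm]
  refine Real.sqrt_le_sqrt ?_
  have hcs : (∑ i, a i) ^ 2 ≤ (Finset.univ : Finset (Fin n)).card * ∑ i, a i ^ 2 :=
    sq_sum_le_card_mul_sum_sq
  rw [Finset.card_univ, Fintype.card_fin] at hcs
  calc ((n : ℝ)⁻¹ * ∑ i, a i) ^ 2 = (n : ℝ)⁻¹ * ((n : ℝ)⁻¹ * (∑ i, a i) ^ 2) := by ring
    _ ≤ (n : ℝ)⁻¹ * ((n : ℝ)⁻¹ * (n * ∑ i, a i ^ 2)) := by gcongr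
    _ = (n : ℝ)⁻¹ * ∑ i, a i ^ 2 := by
        field_simp

/-- Minimal-image displacement of a translated point is at most the length of the translation. -/
theorem euclidDist_add_proj_le (x : T3) (a : V3) :
    Torus.euclidDist (x + Literature.Analysis.FunctionSpaces.Torus.proj a) x ≤ ‖a‖ := by
  rw [Torus.euclidDist_eq, add_sub_cancel_left]
  exact Torus.norm_reprSym_le_of_proj_eq rfl

/-- Triangle inequality for the minimal-image distance (re-proved here to keep imports light). -/
theorem euclidDist_triangle' (x y w : T3) :
    Torus.euclidDist x w ≤ Torus.euclidDist x y + Torus.euclidDist y w := by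
  have hproj : Literature.Analysis.FunctionSpaces.Torus.proj (Torus.reprSym (x - y) + Torus.reprSym (y - w)) =
      x - w := by
    rw [Literature.Analysis.FunctionSpaces.Torus.proj_add, Torus.proj_reprSym, Torus.proj_reprSym]
    abel
  rw [Torus.euclidDist_eq, Torus.euclidDist_eq, Torus.euclidDist_eq]
  exact (Torus.norm_reprSym_le_of_proj_eq hproj).trans (norm_add_le _ _)

/-- The mean speed of a configuration is at most its quadratic-mean speed `√(2K/n)`. -/
theorem mean_speed_le {n : ℕ} (w : Config n (Fin 3) T3) :
    (n : ℝ)⁻¹ * ∑ i, ‖(w i).2‖ ≤ Real.sqrt (2 * ((n : ℝ)⁻¹ * configEnergy w)) := by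
  have h := mean_le_sqrt_mean_sq (fun i => ‖(w i).2‖) fun i => norm_nonneg _
  have hE : 2 * ((n : ℝ)⁻¹ * configEnergy w) = (n : ℝ)⁻¹ * ∑ i, ‖(w i).2‖ ^ 2 := by
    unfold configEnergy
    ring
  rw [hE]
  exact h

/-- The mean minimal-image displacement of a curve in phase space between times `s` and `τ`. -/
def mdisp {n : ℕ} (γ : ℝ → Config n (Fin 3) T3) (s τ : ℝ) : ℝ :=
  (n : ℝ)⁻¹ * ∑ i, Torus.euclidDist ((γ τ i).1) ((γ s i).1)

theorem mdisp_self {n : ℕ} (γ : ℝ → Config n (Fin 3) T3) (s : ℝ) : mdisp γ s s = 0 := by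
  simp [mdisp]

theorem continuous_mdisp {ε : ℝ} {n : ℕ} {γ : ℝ → Config n (Fin 3) T3}
    (h : IsHardSphereTrajectory (Torus.geometry (Fin 3)) ε n γ) (s : ℝ) : Continuous (mdisp γ s) := by
  unfold mdisp
  refine continuous_const.mul (continuous_finsetSum _ fun i _ => ?_)
  have h1 : Continuous fun τ => (γ τ i).1 := h.pos_continuous i
  have h2 : Continuous fun τ : ℝ => (γ τ i).1 - (γ s i).1 := h1.sub continuous_const
  -- NB: `Torus.continuous_euclidDist.comp (h1.prodMk continuous_const)` times out at `isDefEq`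
  -- (`Prod.fst` coincidence `T3 × T3` vs `T3 × V3`); go through `‖reprSym (· − ·)‖` instead.
  simp only [Torus.euclidDist_eq]
  exact Torus.continuous_norm_reprSym.comp h2

/-- One free-flight step of the clock: on a collision-free stretch `[x, y]` issued from `γ x`, the mean
displacement grows by at most `(y − x)·√(2K/n)`. -/
theorem mdisp_freeFlight_step {n : ℕ} (γ : ℝ → Config n (Fin 3) T3) (s : ℝ) {x y : ℝ} (hxy : x < y)
    (hflight : γ y = freeFlight (Torus.geometry (Fin 3)) (y - x) (γ x)) :
    mdisp γ s y - mdisp γ s x ≤ (y - x) * Real.sqrt (2 * ((n : ℝ)⁻¹ * configEnergy (γ x))) := by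
  have hstep : ∀ i, Torus.euclidDist ((γ y i).1) ((γ s i).1) - Torus.euclidDist ((γ x i).1) ((γ s i).1)
      ≤ (y - x) * ‖(γ x i).2‖ := by
    intro i
    have htri := euclidDist_triangle' ((γ y i).1) ((γ x i).1) ((γ s i).1)
    have hmove : Torus.euclidDist ((γ y i).1) ((γ x i).1) ≤ (y - x) * ‖(γ x i).2‖ := by
      rw [hflight, freeFlight_apply, Torus.geometry_translate]
      refine (euclidDist_add_proj_le _ _).trans ?_
      rw [norm_smul, Real.norm_eq_abs, abs_of_pos (sub_pos.2 hxy)]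
    linarith
  have hsum : ∑ i, (Torus.euclidDist ((γ y i).1) ((γ s i).1) - Torus.euclidDist ((γ x i).1) ((γ s i).1))
      ≤ ∑ i, (y - x) * ‖(γ x i).2‖ := Finset.sum_le_sum fun i _ => hstep i
  have hn0 : 0 ≤ (n : ℝ)⁻¹ := inv_nonneg.2 (Nat.cast_nonneg n)
  calc mdisp γ s y - mdisp γ s x = (n : ℝ)⁻¹ * ∑ i, (Torus.euclidDist ((γ y i).1) ((γ s i).1) -
        Torus.euclidDist ((γ x i).1) ((γ s i).1)) := by
        simp only [mdisp, Finset.sum_sub_distrib, mul_sub]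
    _ ≤ (n : ℝ)⁻¹ * ∑ i, (y - x) * ‖(γ x i).2‖ := mul_le_mul_of_nonneg_left hsum hn0
    _ = (y - x) * ((n : ℝ)⁻¹ * ∑ i, ‖(γ x i).2‖) := by
        rw [← Finset.mul_sum]
        ring
    _ ≤ (y - x) * Real.sqrt (2 * ((n : ℝ)⁻¹ * configEnergy (γ x))) :=
        mul_le_mul_of_nonneg_left (mean_speed_le (γ x)) (sub_pos.2 hxy).le

/-- **The clock at trajectory level, forward in time**: for every hard-sphere trajectory on `𝕋³` and
`s ≤ s'`, `n⁻¹ ∑ᵢ d(xᵢ(s'), xᵢ(s)) ≤ √(2K(γ s)/n)·(s' − s)`. -/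
theorem traj_meanDisplacement_le {ε : ℝ} {n : ℕ} {γ : ℝ → Config n (Fin 3) T3}
    (h : IsHardSphereTrajectory (Torus.geometry (Fin 3)) ε n γ) {s s' : ℝ} (hss' : s ≤ s') :
    mdisp γ s s' ≤ Real.sqrt (2 * ((n : ℝ)⁻¹ * configEnergy (γ s))) * (s' - s) := by
  have hK : ∀ τ, configEnergy (γ τ) = configEnergy (γ s) := fun τ =>
    IsHardSphereTrajectory.configEnergy_eq_holds h τ s
  have key : ∀ ⦃x⦄, x ∈ Icc s s' →
      mdisp γ s x ≤ (fun x => Real.sqrt (2 * ((n : ℝ)⁻¹ * configEnergy (γ s))) * (x - s)) x := by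
    refine image_le_of_liminf_slope_right_le_deriv_boundary (f := mdisp γ s)
      (B := fun x => Real.sqrt (2 * ((n : ℝ)⁻¹ * configEnergy (γ s))) * (x - s))
      (B' := fun _ => Real.sqrt (2 * ((n : ℝ)⁻¹ * configEnergy (γ s))))
      (continuous_mdisp h s).continuousOn ?_ ?_ ?_ ?_
    · rw [mdisp_self, sub_self, mul_zero]
    · exact continuousOn_const.mul (continuousOn_id.sub continuousOn_const)
    · intro x _
      have := ((hasDerivWithinAt_id x (Ici x)).sub_const s).const_mul
        (Real.sqrt (2 * ((n : ℝ)⁻¹ * configEnergy (γ s))))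
      simpa using this
    · intro x _ r hr
      obtain ⟨u, hxu, hfree⟩ := h.exists_Ioo_right_free x
      have hev : ∀ᶠ y in 𝓝[>] x, slope (mdisp γ s) x y < r := by
        filter_upwards [Ioo_mem_nhdsGT hxu] with y hy
        have hxy : x < y := hy.1
        have hflight : γ y = freeFlight (Torus.geometry (Fin 3)) (y - x) (γ x) :=
          h.eq_freeFlight_of_Ioo_free hfree ⟨hxy.le, hy.2⟩
        have hdiff := mdisp_freeFlight_step γ s hxy hflight
        rw [hK x] at hdiff
        rw [slope_def_field, div_lt_iff₀ (sub_pos.2 hxy)]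
        calc mdisp γ s y - mdisp γ s x ≤ (y - x) * Real.sqrt (2 * ((n : ℝ)⁻¹ * configEnergy (γ s))) := hdiff
          _ < r * (y - x) := by
              rw [mul_comm]
              exact mul_lt_mul_of_pos_right hr (sub_pos.2 hxy)
      exact hev.frequently
  exact key ⟨hss', le_rfl⟩

/-- **STUB A — `stub_meanDisplacement`, verbatim signature, PROVED.** -/
theorem stub_meanDisplacement {ε : ℝ} {n : ℕ} (Ψ : HardSphereFlow (Torus.geometry (Fin 3)) ε n)
    {z : Config n (Fin 3) T3} (hz : z ∈ Ψ.good) (s s' : ℝ) :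
    (n : ℝ)⁻¹ * ∑ i, Torus.euclidDist ((Ψ.flow s' z i).1) ((Ψ.flow s z i).1) ≤
      Real.sqrt (2 * ((n : ℝ)⁻¹ * configEnergy z)) * |s' - s| := by
  have h : IsHardSphereTrajectory (Torus.geometry (Fin 3)) ε n fun τ => Ψ.flow τ z := Ψ.isTrajectory z hz
  have hK : ∀ τ, configEnergy (Ψ.flow τ z) = configEnergy z := by
    intro τ
    have h1 : configEnergy (Ψ.flow τ z) = configEnergy (Ψ.flow 0 z) :=
      IsHardSphereTrajectory.configEnergy_eq_holds h τ 0
    rw [h1, Ψ.flow_zero z hz]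
  rcases le_total s s' with hss' | hss'
  · rw [abs_of_nonneg (sub_nonneg.2 hss'), ← hK s]
    exact traj_meanDisplacement_le h hss'
  · rw [abs_of_nonpos (sub_nonpos.2 hss'), neg_sub, ← hK s']
    have hsym : ∑ i, Torus.euclidDist ((Ψ.flow s' z i).1) ((Ψ.flow s z i).1) =
        ∑ i, Torus.euclidDist ((Ψ.flow s z i).1) ((Ψ.flow s' z i).1) :=
      Finset.sum_congr rfl fun i _ => Torus.euclidDist_comm _ _
    rw [hsym]
    exact traj_meanDisplacement_le h hss'

end DrefuteG2.StubA

end
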